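import Literature.MathematicalPhysics.QuantumFieldTheory.Balaban1983to89.B9Thm314GpFlatResolvent

/-!
# `Balaban1983to89.B9Thm314GpFlatMultiLevelTorus` — [B9] THEOREM 3.14 (pp. 426–427, (3.154)) AT `U = 1` FOR THE SCALAR
PROPAGATOR `G′ = Δ′_a⁻¹` ON THE GENUINE `k`-LEVEL TORUS, FILE 3 OF 3: for two nested families `{Ω_j}`, `{Ω′_j}` on one
torus `T_η` and localisations `y, y′ ∈ Ω^{(k)}`, `Ω = Ω_k ∩ Ω′_k`,
`|((G′[Ω] − G′[Ω′])λ)(x)| ≤ C·(L^kη)²·e^{−δ·min(d_Ω, d_Ω′)(y,y′)}·e^{−δ·d(y,y′,Ω)}·|λ|`, `x ∈ B^k(y)`, `supp λ ⊂ B^k(y′)`,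
with `k`-UNIFORM constants and the thresholds «M, R sufficiently large» explicit, plus the assembly ENGINE shared by all
four sup entries of [4] (2.67) (entries 1, 2, 3, 6; = [B9] (3.42) + the p. 398 remark) (no existing module is touched; no fact is minted)

FRAMING (verbatim cell line):
statement-level skeleton of published theorems with citation tags; proofs where landed; nothing here is a claim about the Yang–Mills mass gap

Sources under audit (cell pub-balaban / lit-balaban): T. Bałaban, *Propagators for lattice gauge theories in a
background field*, Commun. Math. Phys. **99** (1985) 389–434 [`Balaban1985BackgroundPropagators`, "B9"], pp. 426–427
[PDF 38–39] (Theorem 3.14, (3.154); held text `paper:balaban1985-cmp99-background-propagators` p0038/p0039, read this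
generation), p. 397 (3.42); T. Bałaban, *Propagators and renormalization transformations for lattice gauge theories. II*,
Commun. Math. Phys. **96** (1984) 223–250 [`Balaban1984PropagatorsII`, "[4]"], (2.67) p. 234, (2.59)–(2.61) pp. 233–234,
p. 235.  Unit `lit-balaban-p21` (Phase-2 proof seat p21 gen 18, HOME `run/shared/lean/pub/lit-balaban/`, free-target
protocol G.5-34(d); B9 fold owner r06, B6 fold owner r03, referee ref-4).

## WHAT IS PRINTED (B9 pp. 426–427, verbatim up to notation)

«… two sequences of domains {Ω_j}, {Ω′_j}, both satisfying the conditions (2.1)-(2.4) in [4], with M and R sufficiently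
large … We construct operators for both sequences and we define Ω = Ω_k ∩ Ω′_k. Let us take localizations determined by
points y, y′ ∈ Ω^{(k)} (i.e. these are cubes Δ̃(y), Δ̃(y′) in the case of operators G′, G, …). We have  **Theorem 3.14.**
If we take a pair of operators constructed for the two sequences {Ω_j}, {Ω′_j}, then their difference satisfies all the
inequalities characteristic for operators of the considered type, with the additional factor exp(−δ₀d(y, y′, Ω)),
d(y, y′, Ω) = inf_{y₁∈Ωᶜ∩T^{(k)}} (|y − y₁| + |y₁ − y′|) (3.154) on the right-hand sides.  This theorem can be proved in
exactly the same way as the corresponding property in the theorem of [2]. We take random walk expansions for both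
operators, and in the difference all terms for walks with localizations contained in Ω are cancelled. Remaining terms
correspond to walks of the general type (3.107), for which at least one localization X_i intersects Ωᶜ. Then the
exponential factor in (3.108) gives the factor (3.154) (after adjusting a definition of δ₀).»  The «inequality
characteristic» for `G′` is (3.42)₁ p. 397 = [4] (2.67)₁: «|(G′(U)λ)(x)| ≤ B₀(Lʲη)²e^{−δ₀d(y,y′)}|λ| for x ∈ Δ(y), y ∈ Λ_j,
supp λ ⊂ Δ(y′)».

## WHAT THIS FILE CERTIFIES (kernel-checked; lattice units `η = 1`; setting of file 1 `B9Thm314GpFlatTorusGeometry`)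

**`thm314_Gp_flat_multiLevelTorus`** — there are `δ, C, M₀ > 0` and `N₀ ≥ 1` (functions of `d`, `L` and the weight
window, NOT of the torus, of `k`, or of the families) such that for every `k`, `M_h ≥ 3` with `L·M_h ≥ M₀` («M sufficiently
large»), `R ≥ 2L` with `R·L·M_h ≥ N₀ + 1` («R sufficiently large», (2.59)), `P_μ ≥ 4`, EVERY TWO nested families `D, D′` of
the torus (2.1)–(2.2) (levels `1 … k`, `Ω₁ = Ω′₁ = T_η`), windowed weights `a_{i+1} = aNext ℓ a_i c_i`, every two TOP blocks
`y, y′` of `Ω = Ω_k ∩ Ω′_k` (blocks `B^k(y)`, `B^k(y′)` at level `k` in BOTH families), `supp λ ⊂ B^k(y′)`, `|λ| ≤ B`,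
`x ∈ B^k(y)`:
`|((G′[D] − G′[D′])λ)(x)| ≤ C·L^{2k}·e^{−δ·min(d_D(y,y′), d_{D′}(y,y′))}·e^{−δ·d(y,y′,Ω)}·B`,
`G′[D] = gmlT … D.lev a`, `d_D` = the torus multiscale distance (2.46) of the family (`geomT`), `d(y, y′, Ω)` = (3.154) of
file 1 (`dOmega`).  Route (declared; `U = 1` admits it — print's walk-expansion proof is replaced by the resolvent identity
of file 1 and the resolvent estimate of file 2 `B9Thm314GpFlatResolvent.resolvent_bound`): §3 the trivial two-term bound
from the characteristic inequalities of the two operators (`trivial_bound`) and `min(P²F, Q²F) ≤ PQF` (`combined_bound`)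
give the printed PRODUCT of the characteristic factor (with `min(d_D, d_{D′})`, as print's proof — a sum of terms of the
two expansions — yields) and the (3.154) factor; the (2.60)-transfer threshold `L² ≤ e^{¼δ(R·L·M_h − 1)}` and the (2.61)
constant at the rate `¼δ` are `k`-uniform (`consts_260_261`, from `lemma21_torus`); §4 **`engine`/`engine_pow`** — the
assembly for a composite `A_L·G′·A_R` from FOUR block majorants at one rate (the composite in both families, `A_L·G′[D]`,
`G′[D′]·A_R`), shared with the other sup entries; the theorem = the engine with `A_L = A_R = 1` and the torus (2.67)₁
`B6Prop22MultiLevelTorus.prop22_first_multiLevelTorus` fed in for BOTH families (weights repaired at the unused level `0`,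
`weights_repair`); `thm314_Gp_flat_nonvacuous` — the hypotheses are met (admissible `M_h, R, P`, two families, a common
top block exist for every `k ≥ 1`).

## HONEST SCOPE

* `U = 1` only (no background gauge field; B9 states Theorem 3.14 for regular `U` and ALL operators `G′, G, G₁, 𝔊, H,
  H₁, (Q′G′²Q′*)⁻¹, (QGQ*)⁻¹, …` and ALL characteristic inequalities (3.42)–(3.48)); certified here: the operator `G′`
  and the sup entry (3.42)₁ = [4] (2.67)₁ (the entries [4] (2.67)₂,₃,₆ follow from `engine_pow` in a sibling file; not the
  Hölder or `L²` members, nor the other operators).  Setting = the torus lineage of this seat: `Ω₁ = T_η`, levels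
  `1 … k`, `A = 0`, `m² = 0`, lattice units (`(L^kη)² ↦ L^{2k}`), `P_μ ≥ 4`, big blocks = cubes of the grids
  `(M·L^j)ℤ^{d+1}`.
* (3.154) as in file 1: `k`-block centres, torus sup-distance in units of `L^k`, `Ωᶜ` read on `k`-blocks, `inf ∅ := 0`
  (then the two operators coincide, file 1 `gmlT_eq_of_lev_eq`).  The characteristic factor carries
  `min(d_D(y,y′), d_{D′}(y,y′))` (the two families have two multiscale distances; print writes one `d(y, y′)`).
* The constants: with `C₀`, `δ₁` the constant and rate of the torus (2.67)₁ majorant (`B6Prop22MultiLevelTorus`), `c` the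
  (2.61)-constant `K261 …` of the torus at the rate `¼δ₁`: `C = √(2C₀)·√(C₀·2C₀·max(a₊,a₋)·L²·e^{(3/2)δ₁}·c) + 1`,
  `δ = ¼δ₁`; thresholds `M₀` = that of (2.67)₁, `N₀` = the max of that of (2.67)₁, `⌈8L/δ₁⌉` ((2.60) transfer) and the
  (2.61) summability threshold; all `k`-uniform and independent of the two families.
* A different (resolvent) proof of the printed statement on a model family, declared; nothing is inferred from the
  manuscript: every step is kernel-checked; the quoted sentences locate the statements.
-/

namespace Literature.MathematicalPhysics.QuantumFieldTheory.Balaban1983to89.B9Thm314GpFlatMultiLevelTorus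

open Finset Matrix
open Literature.MathematicalPhysics.QuantumFieldTheory.Balaban1983to89.B4Reflection242 (boxDom mem_boxDom blk avgK)
open Literature.MathematicalPhysics.QuantumFieldTheory.Balaban1983to89.B6MultiLevelBoxOperator
open Literature.MathematicalPhysics.QuantumFieldTheory.Balaban1983to89.B6MultiLevelTorusOperator
open Literature.MathematicalPhysics.QuantumFieldTheory.Balaban1983to89.B6Geom246MultiLevelBox
open Literature.MathematicalPhysics.QuantumFieldTheory.Balaban1983to89.B6Geom246MultiLevelTorus
open Literature.MathematicalPhysics.QuantumFieldTheory.Balaban1983to89.B8Ineq192MultiLevelTorus (geomTB geomTB_dist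
  geomTB_L geomTB_RM levelSepTB lenT_eq symmT)
open Literature.MathematicalPhysics.QuantumFieldTheory.Balaban1983to89.B6Prop22MultiLevelTorus (prop22_first_multiLevelTorus
  mlOpT_congr_weights)
open Literature.MathematicalPhysics.QuantumFieldTheory.Balaban1983to89.B6RandomWalk (HasMajorant BlockSupp blockPiece
  sum_blockPiece hasMajorant_mono)
open Literature.MathematicalPhysics.QuantumFieldTheory.Balaban1983to89.B6Ineq261LevelGap (K261 K261_nonneg
  theta_lt_one_of_log)
open Literature.MathematicalPhysics.QuantumFieldTheory.Balaban1983to89.B6Ineq243TwoLevelBox (aNext)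
open Literature.MathematicalPhysics.QuantumFieldTheory.Balaban1983to89.B6Lemma21Repaired (Ineq261With)
open Literature.MathematicalPhysics.QuantumFieldTheory.Balaban1983to89.B6Ineq268 (mx LevelSep ratio ratio_mul_exp_le)
open Literature.MathematicalPhysics.QuantumFieldTheory.Balaban1983to89.B9Thm314GpFlatTorusGeometry
open Literature.MathematicalPhysics.QuantumFieldTheory.Balaban1983to89.B9Thm314GpFlatResolvent

noncomputable section

variable {d : ℕ}

/-! ## §3 The trivial two-term bound, the combination `min(P²F, Q²F) ≤ PQF`, rate and threshold bookkeeping -/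

section Combine

variable {ℓ Mh k R : ℕ} {P : Fin (d + 1) → ℕ} (D D' : TDomains d ℓ Mh k P R)

/-- block support is the same notion in both families for a COMMON block. [cite: Balaban1984PropagatorsII, (2.51) p.232, dictionary] -/
theorem blockSupp_transfer {p : ℕ × (Fin (d + 1) → ℤ)} (hp : p ∈ bset D.toDomains) (hp' : p ∈ bset D'.toDomains)
    {μv : ↥(boxDom (N0 ℓ Mh k P)) → ℝ} {B : ℝ} (h : BlockSupp (g := geomT D) (blkOf D.toDomains) μv ⟨p, hp⟩ B) :
    BlockSupp (g := geomT D') (blkOf D'.toDomains) μv ⟨p, hp'⟩ B where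
  nonneg := h.nonneg
  bound := fun x hx => h.bound x ((blkOf_eq_iff_blkOf_eq D D' hp hp' x).2 hx)
  off := fun x hx => h.off x fun h' => hx ((blkOf_eq_iff_blkOf_eq D D' hp hp' x).1 h')

omit D D' in
/-- `X ≤ P²F`, `X ≤ Q²F`, `F ≥ 0` ⟹ `X ≤ PQF` (`P, Q ≥ 0`). [cite: Balaban1985BackgroundPropagators, Thm 3.14 p.427 («after adjusting a definition of δ₀»), dictionary] -/
theorem le_mul_mul_of_sq {X P Q F : ℝ} (hP : 0 ≤ P) (hQ : 0 ≤ Q) (hF : 0 ≤ F) (h1 : X ≤ P ^ 2 * F)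
    (h2 : X ≤ Q ^ 2 * F) : X ≤ P * Q * F := by
  rcases le_total P Q with h | h
  · refine h1.trans (mul_le_mul_of_nonneg_right ?_ hF)
    rw [pow_two]; exact mul_le_mul_of_nonneg_left h hP
  · refine h2.trans (mul_le_mul_of_nonneg_right ?_ hF)
    rw [pow_two, mul_comm]; exact mul_le_mul_of_nonneg_right h hQ

/-- **THE TRIVIAL BOUND**: each of the two composites obeys its characteristic inequality with the row weight `K(y)`, hence
`|((T[D] − T[D′])λ)(x)| ≤ 2K(y)·e^{−δ·min(d_D(y,y′), d_{D′}(y,y′))}·B` for common blocks `y ∋ x`, `y′ ⊃ supp λ`.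
[cite: Balaban1984PropagatorsII, Prop. 2.2 (2.67) p.234; Balaban1985BackgroundPropagators, (3.42) p.397] -/
theorem trivial_bound (TD TD' : Matrix ↥(boxDom (N0 ℓ Mh k P)) ↥(boxDom (N0 ℓ Mh k P)) ℝ)
    {KT : ℕ × (Fin (d + 1) → ℤ) → ℝ} {δ : ℝ} (hδ : 0 ≤ δ)
    (hT : HasMajorant (g := geomT D) (blkOf D.toDomains) (Matrix.toLin' TD)
      (fun y y' => KT y.1 * Real.exp (-(δ * (geomT D).dist y y'))))
    (hT' : HasMajorant (g := geomT D') (blkOf D'.toDomains) (Matrix.toLin' TD')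
      (fun y y' => KT y.1 * Real.exp (-(δ * (geomT D').dist y y'))))
    {p q : ℕ × (Fin (d + 1) → ℤ)} (hpD : p ∈ bset D.toDomains) (hpD' : p ∈ bset D'.toDomains)
    (hqD : q ∈ bset D.toDomains) (hqD' : q ∈ bset D'.toDomains) (hKT : 0 ≤ KT p)
    {μv : ↥(boxDom (N0 ℓ Mh k P)) → ℝ} {B : ℝ} (hμ : BlockSupp (g := geomT D) (blkOf D.toDomains) μv ⟨q, hqD⟩ B)
    {x : ↥(boxDom (N0 ℓ Mh k P))} (hx : blkOf D.toDomains x = ⟨p, hpD⟩) :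
    |((TD - TD') *ᵥ μv) x|
      ≤ 2 * KT p * Real.exp (-(δ * min ((geomT D).dist ⟨p, hpD⟩ ⟨q, hqD⟩) ((geomT D').dist ⟨p, hpD'⟩ ⟨q, hqD'⟩))) * B := by
  have hB : 0 ≤ B := hμ.nonneg
  have hx' : blkOf D'.toDomains x = ⟨p, hpD'⟩ := (blkOf_eq_iff_blkOf_eq D D' hpD hpD' x).1 hx
  have h1 := hT ⟨q, hqD⟩ μv B hμ x
  have h2 := hT' ⟨q, hqD'⟩ μv B (blockSupp_transfer D D' hqD hqD' hμ) x
  rw [Matrix.toLin'_apply, hx] at h1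
  rw [Matrix.toLin'_apply, hx'] at h2
  dsimp only at h1 h2
  have hm1 : Real.exp (-(δ * (geomT D).dist ⟨p, hpD⟩ ⟨q, hqD⟩))
      ≤ Real.exp (-(δ * min ((geomT D).dist ⟨p, hpD⟩ ⟨q, hqD⟩) ((geomT D').dist ⟨p, hpD'⟩ ⟨q, hqD'⟩))) :=
    Real.exp_le_exp.2 (by nlinarith [min_le_left ((geomT D).dist ⟨p, hpD⟩ ⟨q, hqD⟩) ((geomT D').dist ⟨p, hpD'⟩ ⟨q, hqD'⟩)])
  have hm2 : Real.exp (-(δ * (geomT D').dist ⟨p, hpD'⟩ ⟨q, hqD'⟩))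
      ≤ Real.exp (-(δ * min ((geomT D).dist ⟨p, hpD⟩ ⟨q, hqD⟩) ((geomT D').dist ⟨p, hpD'⟩ ⟨q, hqD'⟩))) :=
    Real.exp_le_exp.2 (by nlinarith [min_le_right ((geomT D).dist ⟨p, hpD⟩ ⟨q, hqD⟩) ((geomT D').dist ⟨p, hpD'⟩ ⟨q, hqD'⟩)])
  rw [Matrix.sub_mulVec, Pi.sub_apply]
  calc |(TD *ᵥ μv) x - (TD' *ᵥ μv) x| ≤ |(TD *ᵥ μv) x| + |(TD' *ᵥ μv) x| := abs_sub _ _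
    _ ≤ KT p * Real.exp (-(δ * (geomT D).dist ⟨p, hpD⟩ ⟨q, hqD⟩)) * B
        + KT p * Real.exp (-(δ * (geomT D').dist ⟨p, hpD'⟩ ⟨q, hqD'⟩)) * B := add_le_add h1 h2
    _ ≤ KT p * Real.exp (-(δ * min ((geomT D).dist ⟨p, hpD⟩ ⟨q, hqD⟩) ((geomT D').dist ⟨p, hpD'⟩ ⟨q, hqD'⟩))) * B
        + KT p * Real.exp (-(δ * min ((geomT D).dist ⟨p, hpD⟩ ⟨q, hqD⟩) ((geomT D').dist ⟨p, hpD'⟩ ⟨q, hqD'⟩))) * B :=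
        add_le_add (mul_le_mul_of_nonneg_right (mul_le_mul_of_nonneg_left hm1 hKT) hB)
          (mul_le_mul_of_nonneg_right (mul_le_mul_of_nonneg_left hm2 hKT) hB)
    _ = _ := by ring

omit D D' in
/-- **BOTH FACTORS AT ONCE** (print's shape): from the trivial bound `X ≤ A·F·e^{−δm}` and the resolvent estimate
`X ≤ K·F·e^{−½δd_Ω}`: `X ≤ √A·√K·F·e^{−½δm}·e^{−¼δd_Ω}`. [cite: Balaban1985BackgroundPropagators, Thm 3.14 (3.154) pp.426–427 («with the additional factor … after adjusting a definition of δ₀»)] -/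
theorem combined_bound {X A K δ m dΩ F : ℝ} (hA : 0 ≤ A) (hK : 0 ≤ K) (hF : 0 ≤ F)
    (h1 : X ≤ A * F * Real.exp (-(δ * m))) (h2 : X ≤ K * F * Real.exp (-(1 / 2 * δ * dΩ))) :
    X ≤ Real.sqrt A * Real.sqrt K * F * Real.exp (-(1 / 2 * δ * m)) * Real.exp (-(1 / 4 * δ * dΩ)) := by
  have e1 : A * F * Real.exp (-(δ * m)) = (Real.sqrt A * Real.exp (-(1 / 2 * δ * m))) ^ 2 * F := by
    rw [mul_pow, Real.sq_sqrt hA, pow_two, ← Real.exp_add]; ring_nf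
  have e2 : K * F * Real.exp (-(1 / 2 * δ * dΩ)) = (Real.sqrt K * Real.exp (-(1 / 4 * δ * dΩ))) ^ 2 * F := by
    rw [mul_pow, Real.sq_sqrt hK, pow_two, ← Real.exp_add]; ring_nf
  rw [e1] at h1
  rw [e2] at h2
  have h := le_mul_mul_of_sq (by positivity) (by positivity) hF h1 h2
  calc X ≤ _ := h
    _ = _ := by ring

omit D D' in
/-- lowering the rate of a block majorant (`d ≥ 0`). [cite: Balaban1984PropagatorsII, (2.67) p.234, dictionary] -/
theorem hasMajorant_rate_mono (D₀ : TDomains d ℓ Mh k P R) (hMh : 1 ≤ Mh) (hP : ∀ μ, 1 ≤ P μ)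
    {T : Module.End ℝ (↥(boxDom (N0 ℓ Mh k P)) → ℝ)} (K : ↥(bset D₀.toDomains) → ℝ) (hK : ∀ y, 0 ≤ K y)
    {δ₁ δ₂ : ℝ} (hδ : δ₂ ≤ δ₁)
    (h : HasMajorant (g := geomT D₀) (blkOf D₀.toDomains) T (fun y y' => K y * Real.exp (-(δ₁ * (geomT D₀).dist y y')))) :
    HasMajorant (g := geomT D₀) (blkOf D₀.toDomains) T (fun y y' => K y * Real.exp (-(δ₂ * (geomT D₀).dist y y'))) := by
  refine hasMajorant_mono (g := geomT D₀) (blkOf D₀.toDomains) h fun y y' => ?_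
  refine mul_le_mul_of_nonneg_left (Real.exp_le_exp.2 ?_) (hK y)
  have := (triangle_refl_nonneg_T D₀ hMh hP).2.2 y y'
  nlinarith

omit D D' in
/-- reshaping a block majorant by a pointwise identity of the kernels. [cite: Balaban1984PropagatorsII, (2.67) p.234, dictionary] -/
theorem hasMajorant_of_eq (D₀ : TDomains d ℓ Mh k P R) {T : Module.End ℝ (↥(boxDom (N0 ℓ Mh k P)) → ℝ)}
    {K K' : ↥(bset D₀.toDomains) → ↥(bset D₀.toDomains) → ℝ}
    (h : HasMajorant (g := geomT D₀) (blkOf D₀.toDomains) T K) (hK : ∀ y y', K y y' = K' y y') :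
    HasMajorant (g := geomT D₀) (blkOf D₀.toDomains) T K' :=
  hasMajorant_mono (g := geomT D₀) (blkOf D₀.toDomains) h fun y y' => (hK y y').le

omit D D' in
/-- the `L² ≤ e^{¼δ·N}` threshold from `8L/δ ≤ N` (`log L ≤ L − 1`). [cite: Balaban1984PropagatorsII, p.235 («using the exponential factor e^{−¼δ₀d(y,y′)} and the estimate (2.60)»), (2.59) p.233] -/
theorem sq_le_exp_of_threshold {Lr δ N : ℝ} (hL : 1 ≤ Lr) (hδ : 0 < δ) (hN : 8 * Lr / δ ≤ N) :
    Lr ^ 2 ≤ Real.exp (1 / 4 * δ * N) := by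
  have hL0 : 0 < Lr := lt_of_lt_of_le one_pos hL
  have hlog : Real.log Lr ≤ Lr := (Real.log_le_sub_one_of_pos hL0).trans (by linarith)
  have hN' : 8 * Lr ≤ δ * N := by rwa [div_le_iff₀' hδ] at hN
  have e : Real.exp (2 * Real.log Lr) = Lr ^ 2 := by
    have h2 : (2 : ℝ) * Real.log Lr = Real.log (Lr ^ 2) := by
      rw [Real.log_pow]; norm_num
    rw [h2, Real.exp_log (by positivity)]
  calc Lr ^ 2 = Real.exp (2 * Real.log Lr) := e.symm
    _ ≤ Real.exp (1 / 4 * δ * N) := Real.exp_le_exp.2 (by nlinarith)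

omit D D' in
/-- the (2.61) summability threshold at the rate `¼δ`: `e^{−¼δ}·L^{2(d+1)/N} < 1` for `N = ⌈16(d+1)L/(¼δ)⌉ + 1`-type.
[cite: Balaban1984PropagatorsII, (2.59) p.233, (2.61) p.234] -/
theorem theta_threshold (d ℓ : ℕ) {σ : ℝ} (hσ : 0 < σ) :
    Real.exp (-σ) * ((ℓ : ℝ) + 1) ^ ((2 * (d + 1 : ℕ) : ℝ) / (⌈4 * ((d : ℝ) + 1) * ((ℓ : ℝ) + 1) / σ⌉₊ + 1 : ℕ)) < 1 := by
  have hL0 : (0 : ℝ) < (ℓ : ℝ) + 1 := by positivity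
  have hL1 : (1 : ℝ) ≤ (ℓ : ℝ) + 1 := by linarith [(Nat.cast_nonneg ℓ : (0 : ℝ) ≤ ℓ)]
  refine theta_lt_one_of_log hL0 (by omega) ?_
  have hlog : Real.log ((ℓ : ℝ) + 1) ≤ (ℓ : ℝ) + 1 := (Real.log_le_sub_one_of_pos hL0).trans (by linarith)
  have hge : 4 * ((d : ℝ) + 1) * ((ℓ : ℝ) + 1) / σ < (⌈4 * ((d : ℝ) + 1) * ((ℓ : ℝ) + 1) / σ⌉₊ : ℝ) + 1 :=
    lt_of_le_of_lt (Nat.le_ceil _) (by linarith)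
  rw [div_lt_iff₀ hσ] at hge
  push_cast
  nlinarith [mul_nonneg (by positivity : (0 : ℝ) ≤ 2 * ((d : ℝ) + 1)) (Real.log_nonneg hL1),
    mul_nonneg (by positivity : (0 : ℝ) ≤ 2 * ((d : ℝ) + 1)) (sub_nonneg.2 hlog),
    mul_nonneg (by positivity : (0 : ℝ) ≤ 2 * ((d : ℝ) + 1)) hL0.le]

omit D D' in
/-- repairing the weights at the unused level `0`: `a′ = a` at levels `≥ 1`, `a′ ∈ [0, max(a₊, a₋)]`, `a′ > 0` at levels `≥ 1`.
[cite: Balaban1984PropagatorsII, (2.10) p.225 («a_k(L^kη)^{-2} …», levels 1 … k only), dictionary] -/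
theorem weights_repair {a : ℕ → ℝ} {aminus aplus : ℝ} (ha : 0 < aminus) (haw : ∀ i, 1 ≤ i → aminus ≤ a i ∧ a i ≤ aplus) :
    ∃ a' : ℕ → ℝ, (∀ j, 0 ≤ a' j) ∧ (∀ j, a' j ≤ max aplus aminus) ∧ (∀ j, 1 ≤ j → 0 < a' j) ∧
      (∀ j, 1 ≤ j → a j = a' j) := by
  refine ⟨fun j => if j = 0 then aminus else a j, fun j => ?_, fun j => ?_, fun j hj => ?_, fun j hj => ?_⟩
  · dsimp only; split_ifs with h0
    · exact ha.le
    · exact ha.le.trans (haw j (Nat.pos_of_ne_zero h0)).1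
  · dsimp only; split_ifs with h0
    · exact le_max_right _ _
    · exact (haw j (Nat.pos_of_ne_zero h0)).2.trans (le_max_left _ _)
  · dsimp only; rw [if_neg (by omega)]; exact lt_of_lt_of_le ha (haw j hj).1
  · dsimp only; rw [if_neg (by omega)]

omit D D' in
/-- `G′` only sees the weights at levels `≥ 1`. [cite: Balaban1984PropagatorsII, (2.10) p.225, dictionary] -/
theorem gmlT_congr (D₀ : TDomains d ℓ Mh k P R) {a a' : ℕ → ℝ} (h : ∀ j, 1 ≤ j → a j = a' j) :
    gmlT (N0 ℓ Mh k P) ℓ k D₀.lev a = gmlT (N0 ℓ Mh k P) ℓ k D₀.lev a' := by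
  unfold gmlT; rw [mlOpT_congr_weights D₀.one_le_lev h]

omit D D' in
/-- the `k`-UNIFORM thresholds and constants of the assembly at a rate `δ > 0`: an `N` and a `c ≥ 0` such that
`R·L·M_h ≥ N + 1` gives the (2.60)-transfer threshold `L² ≤ e^{¼δ(R·L·M_h − 1)}` and (2.61) at the rate `¼δ` with the
constant `c` for EVERY torus family. [cite: Balaban1984PropagatorsII, (2.59)–(2.61) pp.233–234, p.235] -/
theorem consts_260_261 (d ℓ : ℕ) {δ : ℝ} (hδ : 0 < δ) :
    ∃ (N : ℕ) (c : ℝ), 0 < N ∧ 0 ≤ c ∧ ∀ (k Mh R : ℕ) (P : Fin (d + 1) → ℕ), 1 ≤ Mh → (∀ μ, 1 ≤ P μ) →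
      N + 1 ≤ R * ((ℓ + 1) * Mh) →
      ((ℓ : ℝ) + 1) ^ 2 ≤ Real.exp (1 / 4 * δ * ((R : ℝ) * (((ℓ : ℝ) + 1) * Mh) - 1)) ∧
      ∀ D : TDomains d ℓ Mh k P R, Ineq261With c (geomT D) δ (1 / 4) := by
  have hL1 : (1 : ℝ) ≤ (ℓ : ℝ) + 1 := by linarith [(Nat.cast_nonneg ℓ : (0 : ℝ) ≤ ℓ)]
  set N₁ : ℕ := ⌈8 * ((ℓ : ℝ) + 1) / δ⌉₊ with hN₁
  set N₂ : ℕ := ⌈4 * ((d : ℝ) + 1) * ((ℓ : ℝ) + 1) / (1 / 4 * δ)⌉₊ + 1 with hN₂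
  have hN₂pos : 0 < N₂ := by rw [hN₂]; omega
  have hθlt := theta_threshold d ℓ (σ := 1 / 4 * δ) (by positivity)
  refine ⟨max N₁ N₂, K261 N₂ (d + 1) ((ℓ : ℝ) + 1) 1 (1 / 4 * δ), lt_of_lt_of_le hN₂pos (le_max_right _ _),
    K261_nonneg (by positivity) zero_le_one, ?_⟩
  intro k Mh R P hMh hP hRM
  have hRM1 : N₁ + 1 ≤ R * ((ℓ + 1) * Mh) := le_trans (by simp only [add_le_add_iff_right]; exact le_max_left _ _) hRM
  have hRM2 : N₂ + 1 ≤ R * ((ℓ + 1) * Mh) := le_trans (by simp only [add_le_add_iff_right]; exact le_max_right _ _) hRM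
  refine ⟨sq_le_exp_of_threshold hL1 hδ ?_, fun D => ?_⟩
  · have h1 : 8 * ((ℓ : ℝ) + 1) / δ ≤ N₁ := by rw [hN₁]; exact Nat.le_ceil _
    have h2 : ((N₁ : ℕ) : ℝ) + 1 ≤ (R : ℝ) * (((ℓ : ℝ) + 1) * Mh) := by exact_mod_cast hRM1
    linarith
  · obtain ⟨-, h261, -, -⟩ := lemma21_torus D hMh hP hN₂pos hRM2 hδ.le (α := 1 / 4) (by norm_num) (by norm_num) hθlt
    exact h261

omit D D' in
/-- the power bookkeeping of the four sup entries: `√(2C_T L^{n_T k})·√(C_L L^{n_L k}·K·L^{mk}/L^{2k}) = √(2C_T)·√(C_LK)·L^{n_T k}`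
when `n_T + 2 = n_L + m` ([4] (2.67)₁,₂,₃,₆: `(n_T, n_L, m) = (2,2,2), (1,1,2), (1,2,1), (0,0,2)` for `G′, ∇G′, G′∇*, ΔG′`).
[cite: Balaban1984PropagatorsII, (2.67) p.234; Balaban1985BackgroundPropagators, (3.42) p.397, dictionary] -/
theorem sqrt_weights {Lr CT CL K : ℝ} (hL : 0 < Lr) (hCT : 0 ≤ CT) (hCL : 0 ≤ CL) (hK : 0 ≤ K) {nT nL m : ℕ} (k : ℕ)
    (h : nT + 2 = nL + m) :
    Real.sqrt (2 * (CT * Lr ^ (nT * k))) * Real.sqrt (CL * Lr ^ (nL * k) * K * (Lr ^ (m * k) / Lr ^ (2 * k)))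
      = Real.sqrt (2 * CT) * Real.sqrt (CL * K) * Lr ^ (nT * k) := by
  have hexp : nL * k + m * k = nT * k + 2 * k := by rw [← Nat.add_mul, ← Nat.add_mul, h]
  have hpow : Lr ^ (nL * k) * Lr ^ (m * k) = Lr ^ (nT * k) * Lr ^ (2 * k) := by rw [← pow_add, ← pow_add, hexp]
  have h2k : Lr ^ (2 * k) ≠ 0 := by positivity
  have hX : CL * Lr ^ (nL * k) * K * (Lr ^ (m * k) / Lr ^ (2 * k)) = CL * K * Lr ^ (nT * k) := by
    calc CL * Lr ^ (nL * k) * K * (Lr ^ (m * k) / Lr ^ (2 * k))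
        = CL * K * (Lr ^ (nL * k) * Lr ^ (m * k)) / Lr ^ (2 * k) := by ring
      _ = CL * K * Lr ^ (nT * k) := by rw [hpow, ← mul_assoc, mul_div_cancel_right₀ _ h2k]
  have e1 : 2 * (CT * Lr ^ (nT * k)) = (2 * CT) * Lr ^ (nT * k) := by ring
  rw [hX, e1, Real.sqrt_mul (show (0 : ℝ) ≤ 2 * CT by positivity), Real.sqrt_mul (show (0 : ℝ) ≤ CL * K by positivity)]
  have hs : Real.sqrt (Lr ^ (nT * k)) * Real.sqrt (Lr ^ (nT * k)) = Lr ^ (nT * k) := Real.mul_self_sqrt (by positivity)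
  calc Real.sqrt (2 * CT) * Real.sqrt (Lr ^ (nT * k)) * (Real.sqrt (CL * K) * Real.sqrt (Lr ^ (nT * k)))
      = Real.sqrt (2 * CT) * Real.sqrt (CL * K) * (Real.sqrt (Lr ^ (nT * k)) * Real.sqrt (Lr ^ (nT * k))) := by ring
    _ = _ := by rw [hs]

end Combine


/-! ## §4 Theorem 3.14 at `U = 1` for `G′` (the sup entry (3.42)₁ = [4] (2.67)₁) on the genuine `k`-level torus -/

section Main

variable {ℓ Mh k R : ℕ} {P : Fin (d + 1) → ℕ}

/-- **THE ASSEMBLY ENGINE** (all four sup entries share it; files 2–3): given, for BOTH families and ONE rate `δ`, the block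
majorants of the composite `A_L·G′·A_R` (row weight `K_T`), of the left composite `A_L·G′` (row weight `K_L`) and of the inner
composite `G′·A_R` (weight `C_R·L^{m·j}`), weights `a_j ∈ [0, a₊]` positive at levels `≥ 1`, the (2.61) bound `c` at
`¼δ` on `𝔅[D]` and the (2.60)-threshold, then for common top blocks `y ∋ x`, `y′ ⊃ supp λ`:
`|((A_L(G′[D] − G′[D′])A_R)λ)(x)| ≤ √(2K_T(y))·√(K_L(y)·2C_Ra₊L²e^{(3/2)δ}c·L^{mk}/L^{2k}) · e^{−½δ·min(d_D,d_{D′})(y,y′)} ·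
e^{−¼δ·d(y,y′,Ω)} · B`. [cite: Balaban1985BackgroundPropagators, Thm 3.14 (3.154) pp.426–427] -/
theorem engine (D D' : TDomains d ℓ Mh k P R) (hMh : 1 ≤ Mh) (hP : ∀ μ, 1 ≤ P μ) (hRM : 1 ≤ R * ((ℓ + 1) * Mh))
    {a : ℕ → ℝ} {aplus : ℝ} (ha0 : ∀ j, 0 ≤ a j) (hap : ∀ j, a j ≤ aplus) (ha1 : ∀ j, 1 ≤ j → 0 < a j)
    (m : ℕ) (AL AR : Matrix ↥(boxDom (N0 ℓ Mh k P)) ↥(boxDom (N0 ℓ Mh k P)) ℝ)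
    (KT KL : ℕ × (Fin (d + 1) → ℤ) → ℝ) {CR δ c : ℝ} (hCR : 0 ≤ CR) (hδ : 0 ≤ δ)
    (hT : HasMajorant (g := geomT D) (blkOf D.toDomains)
      (Matrix.toLin' (AL * gmlT (N0 ℓ Mh k P) ℓ k D.lev a * AR)) (fun y y' => KT y.1 * Real.exp (-(δ * (geomT D).dist y y'))))
    (hT' : HasMajorant (g := geomT D') (blkOf D'.toDomains)
      (Matrix.toLin' (AL * gmlT (N0 ℓ Mh k P) ℓ k D'.lev a * AR)) (fun y y' => KT y.1 * Real.exp (-(δ * (geomT D').dist y y'))))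
    (hL : HasMajorant (g := geomT D) (blkOf D.toDomains) (Matrix.toLin' (AL * gmlT (N0 ℓ Mh k P) ℓ k D.lev a))
      (fun y y' => KL y.1 * Real.exp (-(δ * (geomT D).dist y y'))))
    (hR : HasMajorant (g := geomT D') (blkOf D'.toDomains) (Matrix.toLin' (gmlT (N0 ℓ Mh k P) ℓ k D'.lev a * AR))
      (fun y y' => CR * ((ℓ : ℝ) + 1) ^ (m * y.1.1) * Real.exp (-(δ * (geomT D').dist y y'))))
    (h261 : Ineq261With c (geomT D) δ (1 / 4))
    (hthr : ((ℓ : ℝ) + 1) ^ 2 ≤ Real.exp (1 / 4 * δ * ((R : ℝ) * (((ℓ : ℝ) + 1) * Mh) - 1)))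
    {p q : ℕ × (Fin (d + 1) → ℤ)} (hpD : p ∈ bset D.toDomains) (hpD' : p ∈ bset D'.toDomains)
    (hqD : q ∈ bset D.toDomains) (hqD' : q ∈ bset D'.toDomains) (hp : p.1 = k) (hq : q.1 = k)
    (hKT : 0 ≤ KT p) (hKL : 0 ≤ KL p)
    {μv : ↥(boxDom (N0 ℓ Mh k P)) → ℝ} {B : ℝ} (hμ : BlockSupp (g := geomT D) (blkOf D.toDomains) μv ⟨q, hqD⟩ B)
    {x : ↥(boxDom (N0 ℓ Mh k P))} (hx : blkOf D.toDomains x = ⟨p, hpD⟩) :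
    |((AL * gmlT (N0 ℓ Mh k P) ℓ k D.lev a * AR - AL * gmlT (N0 ℓ Mh k P) ℓ k D'.lev a * AR) *ᵥ μv) x|
      ≤ Real.sqrt (2 * KT p)
          * Real.sqrt (KL p * (2 * CR * aplus * ((ℓ : ℝ) + 1) ^ 2 * Real.exp (3 / 2 * δ) * c)
            * (((ℓ : ℝ) + 1) ^ (m * k) / ((ℓ : ℝ) + 1) ^ (2 * k))) * B
        * Real.exp (-(1 / 2 * δ * min ((geomT D).dist ⟨p, hpD⟩ ⟨q, hqD⟩) ((geomT D').dist ⟨p, hpD'⟩ ⟨q, hqD'⟩)))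
        * Real.exp (-(1 / 4 * δ * dOmega D D' p.2 q.2)) := by
  have hB : 0 ≤ B := hμ.nonneg
  have hap0 : 0 ≤ aplus := (ha0 0).trans (hap 0)
  -- the resolvent form of the difference
  have hident : AL * gmlT (N0 ℓ Mh k P) ℓ k D.lev a * AR - AL * gmlT (N0 ℓ Mh k P) ℓ k D'.lev a * AR
      = AL * gmlT (N0 ℓ Mh k P) ℓ k D.lev a * diffM D D' a * gmlT (N0 ℓ Mh k P) ℓ k D'.lev a * AR := by
    rw [← Matrix.sub_mul, Matrix.mul_assoc AL, Matrix.mul_assoc AL, ← Matrix.mul_sub, gmlT_sub_gmlT D D' a hMh hP ha1]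
  have htriv := trivial_bound D D' _ _ hδ hT hT' hpD hpD' hqD hqD' hKT hμ hx
  have hres := resolvent_bound D D' hMh hP hRM ha0 hap m AL AR hCR hδ hL hR h261 hthr (y := ⟨p, hpD⟩) hp hKL
    (y' := ⟨q, hqD'⟩) hq (blockSupp_transfer D D' hqD hqD' hμ) hx
  rw [← hident] at hres
  have h1 : |((AL * gmlT (N0 ℓ Mh k P) ℓ k D.lev a * AR - AL * gmlT (N0 ℓ Mh k P) ℓ k D'.lev a * AR) *ᵥ μv) x|
      ≤ 2 * KT p * B
        * Real.exp (-(δ * min ((geomT D).dist ⟨p, hpD⟩ ⟨q, hqD⟩) ((geomT D').dist ⟨p, hpD'⟩ ⟨q, hqD'⟩))) := by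
    calc _ ≤ _ := htriv
      _ = _ := by ring
  have h2 : |((AL * gmlT (N0 ℓ Mh k P) ℓ k D.lev a * AR - AL * gmlT (N0 ℓ Mh k P) ℓ k D'.lev a * AR) *ᵥ μv) x|
      ≤ KL p * (2 * CR * aplus * ((ℓ : ℝ) + 1) ^ 2 * Real.exp (3 / 2 * δ) * c)
          * (((ℓ : ℝ) + 1) ^ (m * k) / ((ℓ : ℝ) + 1) ^ (2 * k)) * B
        * Real.exp (-(1 / 2 * δ * dOmega D D' p.2 q.2)) := by
    calc _ ≤ _ := hres
      _ = _ := by ring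
  have hK0 : 0 ≤ KL p * (2 * CR * aplus * ((ℓ : ℝ) + 1) ^ 2 * Real.exp (3 / 2 * δ) * c)
      * (((ℓ : ℝ) + 1) ^ (m * k) / ((ℓ : ℝ) + 1) ^ (2 * k)) := by
    have hc0 : 0 ≤ c := le_trans (Finset.sum_nonneg fun b _ => (Real.exp_pos _).le) (h261 ⟨p, hpD⟩)
    positivity
  exact combined_bound (by positivity) hK0 hB h1 h2

/-- **THE ENGINE WITH POWER WEIGHTS** (the form used by all four sup entries): row weights `C_T·L^{n_T j}` (composite),
`C_L·L^{n_L j}` (left factor), inner weight `C_R·L^{m j}` with `n_T + 2 = n_L + m`; then for common top blocks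
`|((A_L(G′[D] − G′[D′])A_R)λ)(x)| ≤ √(2C_T)·√(C_L·2C_Ra₊L²e^{(3/2)δ}c)·L^{n_T k}·e^{−½δ·min(d_D,d_{D′})(y,y′)}·e^{−¼δ·d(y,y′,Ω)}·B`.
[cite: Balaban1985BackgroundPropagators, Thm 3.14 (3.154) pp.426–427, (3.42) p.397] -/
theorem engine_pow (D D' : TDomains d ℓ Mh k P R) (hMh : 1 ≤ Mh) (hP : ∀ μ, 1 ≤ P μ) (hRM : 1 ≤ R * ((ℓ + 1) * Mh))
    {a : ℕ → ℝ} {aplus : ℝ} (ha0 : ∀ j, 0 ≤ a j) (hap : ∀ j, a j ≤ aplus) (ha1 : ∀ j, 1 ≤ j → 0 < a j)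
    (m nT nL : ℕ) (hn : nT + 2 = nL + m) (AL AR : Matrix ↥(boxDom (N0 ℓ Mh k P)) ↥(boxDom (N0 ℓ Mh k P)) ℝ)
    {CT CL CR δ c : ℝ} (hCT : 0 ≤ CT) (hCL : 0 ≤ CL) (hCR : 0 ≤ CR) (hδ : 0 ≤ δ)
    (hT : HasMajorant (g := geomT D) (blkOf D.toDomains)
      (Matrix.toLin' (AL * gmlT (N0 ℓ Mh k P) ℓ k D.lev a * AR))
      (fun y y' => CT * ((ℓ : ℝ) + 1) ^ (nT * y.1.1) * Real.exp (-(δ * (geomT D).dist y y'))))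
    (hT' : HasMajorant (g := geomT D') (blkOf D'.toDomains)
      (Matrix.toLin' (AL * gmlT (N0 ℓ Mh k P) ℓ k D'.lev a * AR))
      (fun y y' => CT * ((ℓ : ℝ) + 1) ^ (nT * y.1.1) * Real.exp (-(δ * (geomT D').dist y y'))))
    (hL : HasMajorant (g := geomT D) (blkOf D.toDomains) (Matrix.toLin' (AL * gmlT (N0 ℓ Mh k P) ℓ k D.lev a))
      (fun y y' => CL * ((ℓ : ℝ) + 1) ^ (nL * y.1.1) * Real.exp (-(δ * (geomT D).dist y y'))))
    (hR : HasMajorant (g := geomT D') (blkOf D'.toDomains) (Matrix.toLin' (gmlT (N0 ℓ Mh k P) ℓ k D'.lev a * AR))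
      (fun y y' => CR * ((ℓ : ℝ) + 1) ^ (m * y.1.1) * Real.exp (-(δ * (geomT D').dist y y'))))
    (h261 : Ineq261With c (geomT D) δ (1 / 4))
    (hthr : ((ℓ : ℝ) + 1) ^ 2 ≤ Real.exp (1 / 4 * δ * ((R : ℝ) * (((ℓ : ℝ) + 1) * Mh) - 1)))
    {p q : ℕ × (Fin (d + 1) → ℤ)} (hpD : p ∈ bset D.toDomains) (hpD' : p ∈ bset D'.toDomains)
    (hqD : q ∈ bset D.toDomains) (hqD' : q ∈ bset D'.toDomains) (hp : p.1 = k) (hq : q.1 = k)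
    {μv : ↥(boxDom (N0 ℓ Mh k P)) → ℝ} {B : ℝ} (hμ : BlockSupp (g := geomT D) (blkOf D.toDomains) μv ⟨q, hqD⟩ B)
    {x : ↥(boxDom (N0 ℓ Mh k P))} (hx : blkOf D.toDomains x = ⟨p, hpD⟩) :
    |((AL * gmlT (N0 ℓ Mh k P) ℓ k D.lev a * AR - AL * gmlT (N0 ℓ Mh k P) ℓ k D'.lev a * AR) *ᵥ μv) x|
      ≤ Real.sqrt (2 * CT) * Real.sqrt (CL * (2 * CR * aplus * ((ℓ : ℝ) + 1) ^ 2 * Real.exp (3 / 2 * δ) * c))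
          * ((ℓ : ℝ) + 1) ^ (nT * k)
        * Real.exp (-(1 / 2 * δ * min ((geomT D).dist ⟨p, hpD⟩ ⟨q, hqD⟩) ((geomT D').dist ⟨p, hpD'⟩ ⟨q, hqD'⟩)))
        * Real.exp (-(1 / 4 * δ * dOmega D D' p.2 q.2)) * B := by
  have hL0 : (0 : ℝ) < (ℓ : ℝ) + 1 := by positivity
  have hap0 : 0 ≤ aplus := (ha0 0).trans (hap 0)
  have hc0 : 0 ≤ c := le_trans (Finset.sum_nonneg fun b _ => (Real.exp_pos _).le) (h261 ⟨p, hpD⟩)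
  have h2 : |((AL * gmlT (N0 ℓ Mh k P) ℓ k D.lev a * AR - AL * gmlT (N0 ℓ Mh k P) ℓ k D'.lev a * AR) *ᵥ μv) x|
      ≤ Real.sqrt (2 * (CT * ((ℓ : ℝ) + 1) ^ (nT * p.1)))
          * Real.sqrt (CL * ((ℓ : ℝ) + 1) ^ (nL * p.1) * (2 * CR * aplus * ((ℓ : ℝ) + 1) ^ 2 * Real.exp (3 / 2 * δ) * c)
            * (((ℓ : ℝ) + 1) ^ (m * k) / ((ℓ : ℝ) + 1) ^ (2 * k))) * B
        * Real.exp (-(1 / 2 * δ * min ((geomT D).dist ⟨p, hpD⟩ ⟨q, hqD⟩) ((geomT D').dist ⟨p, hpD'⟩ ⟨q, hqD'⟩)))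
        * Real.exp (-(1 / 4 * δ * dOmega D D' p.2 q.2)) :=
    engine D D' hMh hP hRM ha0 hap ha1 m AL AR (fun pr => CT * ((ℓ : ℝ) + 1) ^ (nT * pr.1))
      (fun pr => CL * ((ℓ : ℝ) + 1) ^ (nL * pr.1)) hCR hδ hT hT' hL hR h261 hthr hpD hpD' hqD hqD' hp hq
      (show 0 ≤ CT * ((ℓ : ℝ) + 1) ^ (nT * p.1) by positivity) (show 0 ≤ CL * ((ℓ : ℝ) + 1) ^ (nL * p.1) by positivity)
      hμ hx
  rw [hp, sqrt_weights hL0 hCT hCL (K := 2 * CR * aplus * ((ℓ : ℝ) + 1) ^ 2 * Real.exp (3 / 2 * δ) * c)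
    (by positivity) k hn] at h2
  calc _ ≤ _ := h2
    _ = _ := by ring

/-- the shape of a torus (2.67)-type sup entry for the composite `A_L·G′·A_R` (a family indexed by `ι`, e.g. the
directions `μ`): thresholds `M₀, N₀`, constant `C`, weight exponent `n`, rate `δ` — exactly the package the torus Prop. 2.2
lineage delivers (`prop22_first/second/third/sixth_multiLevelTorus`). [cite: Balaban1984PropagatorsII, Prop. 2.2 (2.67) p.234; Balaban1985BackgroundPropagators, (3.42) p.397] -/
def MajFamily (d ℓ : ℕ) (aminus aplus a2minus a2plus : ℝ) {ι : Type}
    (opL opR : ι → ∀ (Mh k : ℕ) (P : Fin (d + 1) → ℕ), Matrix ↥(boxDom (N0 ℓ Mh k P)) ↥(boxDom (N0 ℓ Mh k P)) ℝ)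
    (n : ℕ) (δ C M₀ : ℝ) (N₀ : ℕ) : Prop :=
  ∀ (k Mh R : ℕ), 3 ≤ Mh → M₀ ≤ ((ℓ : ℝ) + 1) * Mh → 2 * (ℓ + 1) ≤ R → N₀ + 1 ≤ R * ((ℓ + 1) * Mh) →
    ∀ (P : Fin (d + 1) → ℕ), (∀ μ, 1 ≤ P μ) → (∀ μ, 4 ≤ P μ) → ∀ (D : TDomains d ℓ Mh k P R) (a c : ℕ → ℝ),
      (∀ i, 1 ≤ i → aminus ≤ a i ∧ a i ≤ aplus) → (∀ i, 1 ≤ i → a2minus ≤ c i ∧ c i ≤ a2plus) →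
      (∀ i, 1 ≤ i → a (i + 1) = aNext ℓ (a i) (c i)) → ∀ i : ι,
      HasMajorant (g := geomT D) (blkOf D.toDomains)
        (Matrix.toLin' (opL i Mh k P * gmlT (N0 ℓ Mh k P) ℓ k D.lev a * opR i Mh k P))
        (fun y y' => C * ((ℓ : ℝ) + 1) ^ (n * y.1.1) * Real.exp (-(δ * (geomT D).dist y y')))

/-- **THE MASTER FORM OF THEOREM 3.14 AT `U = 1` ON THE TORUS** (all four sup entries are its instances): given the
(2.67)-type packages of the composite `A_L·G′·A_R` (exponent `n_T`), of `A_L·G′` (exponent `n_L`) and of `G′·A_R`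
(exponent `m`) with `n_T + 2 = n_L + m`, there are `δ, C, M₀ > 0`, `N₀ ≥ 1` such that for all admissible `k, M_h, R, P`, every
two torus families `D, D′`, windowed weights, common top blocks `y ∋ x`, `y′ ⊃ supp λ` and every index `i`:
`|((A_L(G′[D] − G′[D′])A_R)λ)(x)| ≤ C·L^{n_T k}·e^{−δ·min(d_D,d_{D′})(y,y′)}·e^{−δ·d(y,y′,Ω)}·B`.
[cite: Balaban1985BackgroundPropagators, Thm 3.14 (3.154) pp.426–427, (3.42) p.397; Balaban1984PropagatorsII, (2.67) p.234] -/
theorem thm314_flat_master (d ℓ : ℕ) {aminus aplus a2minus a2plus : ℝ} (ha : 0 < aminus) {ι : Type}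
    (opL opR : ι → ∀ (Mh k : ℕ) (P : Fin (d + 1) → ℕ), Matrix ↥(boxDom (N0 ℓ Mh k P)) ↥(boxDom (N0 ℓ Mh k P)) ℝ)
    (opI : ∀ (Mh k : ℕ) (P : Fin (d + 1) → ℕ), Matrix ↥(boxDom (N0 ℓ Mh k P)) ↥(boxDom (N0 ℓ Mh k P)) ℝ)
    (hI : ∀ Mh k P, opI Mh k P = 1)
    {nT nL m : ℕ} (hn : nT + 2 = nL + m) {δT CT MT δL CL ML δR CR MR : ℝ} {NT NL NR : ℕ}
    (hδT : 0 < δT) (hCT : 0 < CT) (hMT : 0 < MT) (hδL : 0 < δL) (hCL : 0 < CL) (hδR : 0 < δR) (hCR : 0 < CR)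
    (hTm : MajFamily d ℓ aminus aplus a2minus a2plus opL opR nT δT CT MT NT)
    (hLm : MajFamily d ℓ aminus aplus a2minus a2plus opL (fun _ => opI) nL δL CL ML NL)
    (hRm : MajFamily d ℓ aminus aplus a2minus a2plus (fun _ => opI) opR m δR CR MR NR) :
    ∃ δ C M₀ : ℝ, ∃ N₀ : ℕ, 0 < δ ∧ 0 < C ∧ 0 < M₀ ∧ 0 < N₀ ∧
      ∀ (k Mh R : ℕ), 3 ≤ Mh → M₀ ≤ ((ℓ : ℝ) + 1) * Mh → 2 * (ℓ + 1) ≤ R → N₀ + 1 ≤ R * ((ℓ + 1) * Mh) →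
      ∀ (P : Fin (d + 1) → ℕ) (hP : ∀ μ, 1 ≤ P μ) (hP4 : ∀ μ, 4 ≤ P μ) (D D' : TDomains d ℓ Mh k P R)
        (a c : ℕ → ℝ), (∀ i, 1 ≤ i → aminus ≤ a i ∧ a i ≤ aplus) → (∀ i, 1 ≤ i → a2minus ≤ c i ∧ c i ≤ a2plus) →
        (∀ i, 1 ≤ i → a (i + 1) = aNext ℓ (a i) (c i)) →
      ∀ (p q : ℕ × (Fin (d + 1) → ℤ)) (hpD : p ∈ bset D.toDomains) (hpD' : p ∈ bset D'.toDomains)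
        (hqD : q ∈ bset D.toDomains) (hqD' : q ∈ bset D'.toDomains), p.1 = k → q.1 = k →
      ∀ (lam : ↥(boxDom (N0 ℓ Mh k P)) → ℝ) (B : ℝ),
        BlockSupp (g := geomT D) (blkOf D.toDomains) lam ⟨q, hqD⟩ B →
      ∀ x : ↥(boxDom (N0 ℓ Mh k P)), blkOf D.toDomains x = ⟨p, hpD⟩ → ∀ i : ι,
        |((opL i Mh k P * gmlT (N0 ℓ Mh k P) ℓ k D.lev a * opR i Mh k P
            - opL i Mh k P * gmlT (N0 ℓ Mh k P) ℓ k D'.lev a * opR i Mh k P) *ᵥ lam) x|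
          ≤ C * ((ℓ : ℝ) + 1) ^ (nT * k)
              * Real.exp (-(δ * min ((geomT D).dist ⟨p, hpD⟩ ⟨q, hqD⟩) ((geomT D').dist ⟨p, hpD'⟩ ⟨q, hqD'⟩)))
              * Real.exp (-(δ * dOmega D D' p.2 q.2)) * B := by
  have hL0 : (0 : ℝ) < (ℓ : ℝ) + 1 := by positivity
  -- the common rate
  obtain ⟨δ, hδ⟩ : ∃ δ : ℝ, δ = min δT (min δL δR) := ⟨_, rfl⟩
  have hδpos : 0 < δ := by rw [hδ]; exact lt_min hδT (lt_min hδL hδR)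
  have hδT' : δ ≤ δT := by rw [hδ]; exact min_le_left _ _
  have hδL' : δ ≤ δL := by rw [hδ]; exact (min_le_right _ _).trans (min_le_left _ _)
  have hδR' : δ ≤ δR := by rw [hδ]; exact (min_le_right _ _).trans (min_le_right _ _)
  -- the `k`-uniform (2.60)/(2.61) thresholds and constants at the rate `δ`
  obtain ⟨N₁, cK, hN₁, hcK0, hcon⟩ := consts_260_261 d ℓ hδpos
  have hap0 : 0 ≤ max aplus aminus := le_trans ha.le (le_max_right _ _)
  obtain ⟨KR, hKR⟩ : ∃ KR : ℝ, KR = 2 * CR * max aplus aminus * ((ℓ : ℝ) + 1) ^ 2 * Real.exp (3 / 2 * δ) * cK :=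
    ⟨_, rfl⟩
  have hKR0 : 0 ≤ KR := by rw [hKR]; positivity
  refine ⟨1 / 4 * δ, Real.sqrt (2 * CT) * Real.sqrt (CL * KR) + 1, max MT (max ML MR), max (max NT (max NL NR)) N₁,
    by positivity, by positivity, lt_of_lt_of_le hMT (le_max_left _ _), lt_of_lt_of_le hN₁ (le_max_right _ _), ?_⟩
  intro k Mh R hMh hM hR hRM P hP hP4 D D' a c haw hcw hac p q hpD hpD' hqD hqD' hp hq lam B hlam x hx i
  have hMh1 : 1 ≤ Mh := le_trans (by norm_num) hMh
  have hMT' : MT ≤ ((ℓ : ℝ) + 1) * Mh := le_trans (le_max_left _ _) hM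
  have hML' : ML ≤ ((ℓ : ℝ) + 1) * Mh := le_trans ((le_max_left _ _).trans (le_max_right _ _)) hM
  have hMR' : MR ≤ ((ℓ : ℝ) + 1) * Mh := le_trans ((le_max_right _ _).trans (le_max_right _ _)) hM
  have hNT : NT + 1 ≤ R * ((ℓ + 1) * Mh) :=
    le_trans (Nat.add_le_add_right ((le_max_left NT _).trans (le_max_left _ N₁)) 1) hRM
  have hNL : NL + 1 ≤ R * ((ℓ + 1) * Mh) :=
    le_trans (Nat.add_le_add_right (((le_max_left NL NR).trans (le_max_right NT _)).trans (le_max_left _ N₁)) 1) hRM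
  have hNR : NR + 1 ≤ R * ((ℓ + 1) * Mh) :=
    le_trans (Nat.add_le_add_right (((le_max_right NL NR).trans (le_max_right NT _)).trans (le_max_left _ N₁)) 1) hRM
  have hR1 : N₁ + 1 ≤ R * ((ℓ + 1) * Mh) := le_trans (Nat.add_le_add_right (le_max_right _ _) 1) hRM
  have hRMone : 1 ≤ R * ((ℓ + 1) * Mh) := le_trans (by omega) hR1
  obtain ⟨hthr, h261f⟩ := hcon k Mh R P hMh1 hP hR1
  -- the weights with level `0` repaired
  obtain ⟨a', ha'0, ha'p, ha'1, ha'eq⟩ := weights_repair ha haw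
  -- the four majorants, for the repaired weights, at the common rate
  have hT := hTm k Mh R hMh hMT' hR hNT P hP hP4 D a c haw hcw hac i
  have hT' := hTm k Mh R hMh hMT' hR hNT P hP hP4 D' a c haw hcw hac i
  have hLf := hLm k Mh R hMh hML' hR hNL P hP hP4 D a c haw hcw hac i
  have hRf := hRm k Mh R hMh hMR' hR hNR P hP hP4 D' a c haw hcw hac i
  rw [gmlT_congr D ha'eq] at hT hLf
  rw [gmlT_congr D' ha'eq] at hT' hRf
  dsimp only at hLf hRf
  rw [hI, Matrix.mul_one] at hLf
  rw [hI, Matrix.one_mul] at hRf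
  have hT₁ := hasMajorant_rate_mono D hMh1 hP (fun y => CT * ((ℓ : ℝ) + 1) ^ (nT * y.1.1)) (fun y => by positivity)
    hδT' hT
  have hT'₁ := hasMajorant_rate_mono D' hMh1 hP (fun y => CT * ((ℓ : ℝ) + 1) ^ (nT * y.1.1)) (fun y => by positivity)
    hδT' hT'
  have hL₁ := hasMajorant_rate_mono D hMh1 hP (fun y => CL * ((ℓ : ℝ) + 1) ^ (nL * y.1.1)) (fun y => by positivity)
    hδL' hLf
  have hR₁ := hasMajorant_rate_mono D' hMh1 hP (fun y => CR * ((ℓ : ℝ) + 1) ^ (m * y.1.1)) (fun y => by positivity)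
    hδR' hRf
  -- the engine
  have hmain := engine_pow D D' hMh1 hP hRMone ha'0 ha'p ha'1 m nT nL hn (opL i Mh k P) (opR i Mh k P) hCT.le hCL.le
    hCR.le hδpos.le hT₁ hT'₁ hL₁ hR₁ (h261f D) hthr hpD hpD' hqD hqD' hp hq hlam hx
  rw [← gmlT_congr D ha'eq, ← gmlT_congr D' ha'eq, ← hKR] at hmain
  -- constants
  have hB : 0 ≤ B := hlam.nonneg
  have hm0 : 0 ≤ min ((geomT D).dist ⟨p, hpD⟩ ⟨q, hqD⟩) ((geomT D').dist ⟨p, hpD'⟩ ⟨q, hqD'⟩) :=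
    le_min ((triangle_refl_nonneg_T D hMh1 hP).2.2 _ _) ((triangle_refl_nonneg_T D' hMh1 hP).2.2 _ _)
  have hw1 : Real.exp (-(1 / 2 * δ * min ((geomT D).dist ⟨p, hpD⟩ ⟨q, hqD⟩) ((geomT D').dist ⟨p, hpD'⟩ ⟨q, hqD'⟩)))
      ≤ Real.exp (-(1 / 4 * δ * min ((geomT D).dist ⟨p, hpD⟩ ⟨q, hqD⟩) ((geomT D').dist ⟨p, hpD'⟩ ⟨q, hqD'⟩))) :=
    Real.exp_le_exp.2 (by nlinarith)
  have hsq : Real.sqrt (2 * CT) * Real.sqrt (CL * KR) ≤ Real.sqrt (2 * CT) * Real.sqrt (CL * KR) + 1 := by linarith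
  calc _ ≤ _ := hmain
    _ ≤ (Real.sqrt (2 * CT) * Real.sqrt (CL * KR) + 1) * ((ℓ : ℝ) + 1) ^ (nT * k)
          * Real.exp (-(1 / 4 * δ * min ((geomT D).dist ⟨p, hpD⟩ ⟨q, hqD⟩) ((geomT D').dist ⟨p, hpD'⟩ ⟨q, hqD'⟩)))
          * Real.exp (-(1 / 4 * δ * dOmega D D' p.2 q.2)) * B := by
        refine mul_le_mul_of_nonneg_right ?_ hB
        refine mul_le_mul_of_nonneg_right ?_ (Real.exp_pos _).le
        exact mul_le_mul (mul_le_mul_of_nonneg_right hsq (by positivity)) hw1 (Real.exp_pos _).le (by positivity)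
    _ = _ := by ring

/-- **[B9] THEOREM 3.14 AT `U = 1` FOR `G′ = Δ′_a⁻¹` ON THE GENUINE `k`-LEVEL TORUS — THE ENTRY (3.42)₁ = [4] (2.67)₁.**  There
are `δ, C, M₀ > 0` and `N₀ ≥ 1` (functions of `d`, `L` and the weight window) such that for EVERY `k`, `M_h ≥ 3` with
`L·M_h ≥ M₀`, `R ≥ 2L` with `R·L·M_h ≥ N₀ + 1`, `P_μ ≥ 4`, every TWO nested families `D, D′ : TDomains` of the torus
(«two sequences of domains {Ω_j}, {Ω′_j}, both satisfying the conditions (2.1)-(2.4) in [4], with M and R sufficiently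
large»), windowed weights, every two blocks `B^k(y)`, `B^k(y′)` at the top level in BOTH families («localizations determined
by points y, y′ ∈ Ω^{(k)}», `Ω = Ω_k ∩ Ω′_k`), `supp λ ⊂ B^k(y′)`, `|λ| ≤ B` and `x ∈ B^k(y)`:
`|((G′[D] − G′[D′])λ)(x)| ≤ C·L^{2k}·e^{−δ·min(d_D(y,y′), d_{D′}(y,y′))}·e^{−δ·d(y,y′,Ω)}·B`
— «their difference satisfies all the inequalities characteristic for operators of the considered type, with the additional
factor exp(−δ₀d(y, y′, Ω))», here for the characteristic inequality (2.67)₁ of `G′`, `d(y, y′, Ω)` = (3.154) (`dOmega`).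
Inputs BY NAME: the torus (2.67)₁ `B6Prop22MultiLevelTorus.prop22_first_multiLevelTorus` for both families, (2.60)/(2.61) on
the torus (`levelSepTB`, `lemma21_torus`), the resolvent identity and the two-family geometry of file 1.
[cite: Balaban1985BackgroundPropagators, Thm 3.14 (3.154) pp.426–427; Balaban1984PropagatorsII, Prop. 2.2 (2.67) p.234] -/
theorem thm314_Gp_flat_multiLevelTorus (d ℓ : ℕ) (hℓ : 1 ≤ ℓ) (aminus aplus a2minus a2plus : ℝ) (ha : 0 < aminus)
    (ha2 : 0 < a2minus) :
    ∃ δ C M₀ : ℝ, ∃ N₀ : ℕ, 0 < δ ∧ 0 < C ∧ 0 < M₀ ∧ 0 < N₀ ∧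
      ∀ (k Mh R : ℕ), 3 ≤ Mh → M₀ ≤ ((ℓ : ℝ) + 1) * Mh → 2 * (ℓ + 1) ≤ R → N₀ + 1 ≤ R * ((ℓ + 1) * Mh) →
      ∀ (P : Fin (d + 1) → ℕ) (hP : ∀ μ, 1 ≤ P μ) (hP4 : ∀ μ, 4 ≤ P μ) (D D' : TDomains d ℓ Mh k P R)
        (a c : ℕ → ℝ), (∀ i, 1 ≤ i → aminus ≤ a i ∧ a i ≤ aplus) → (∀ i, 1 ≤ i → a2minus ≤ c i ∧ c i ≤ a2plus) →
        (∀ i, 1 ≤ i → a (i + 1) = aNext ℓ (a i) (c i)) →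
      ∀ (p q : ℕ × (Fin (d + 1) → ℤ)) (hpD : p ∈ bset D.toDomains) (hpD' : p ∈ bset D'.toDomains)
        (hqD : q ∈ bset D.toDomains) (hqD' : q ∈ bset D'.toDomains), p.1 = k → q.1 = k →
      ∀ (lam : ↥(boxDom (N0 ℓ Mh k P)) → ℝ) (B : ℝ),
        BlockSupp (g := geomT D) (blkOf D.toDomains) lam ⟨q, hqD⟩ B →
      ∀ x : ↥(boxDom (N0 ℓ Mh k P)), blkOf D.toDomains x = ⟨p, hpD⟩ →
        |((gmlT (N0 ℓ Mh k P) ℓ k D.lev a - gmlT (N0 ℓ Mh k P) ℓ k D'.lev a) *ᵥ lam) x|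
          ≤ C * ((ℓ : ℝ) + 1) ^ (2 * k)
              * Real.exp (-(δ * min ((geomT D).dist ⟨p, hpD⟩ ⟨q, hqD⟩) ((geomT D').dist ⟨p, hpD'⟩ ⟨q, hqD'⟩)))
              * Real.exp (-(δ * dOmega D D' p.2 q.2)) * B := by
  obtain ⟨δ₀, C₀, M₀, N₀, hδ₀, hC₀, hM₀, hN₀, hmaj⟩ := prop22_first_multiLevelTorus d ℓ hℓ aminus aplus a2minus a2plus ha ha2
  -- the (2.67)₁ package serves as all three families (`A_L = A_R = 1`, exponents `(2, 2, 2)`)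
  have hF : MajFamily d ℓ aminus aplus a2minus a2plus (ι := Unit)
      (fun _ Mh k P => (1 : Matrix ↥(boxDom (N0 ℓ Mh k P)) ↥(boxDom (N0 ℓ Mh k P)) ℝ))
      (fun _ Mh k P => (1 : Matrix ↥(boxDom (N0 ℓ Mh k P)) ↥(boxDom (N0 ℓ Mh k P)) ℝ)) 2 (δ₀ / 2) C₀ M₀ N₀ := by
    intro k Mh R hMh hM hR hRM P hP hP4 D a c haw hcw hac _
    rw [Matrix.one_mul, Matrix.mul_one]
    exact hmaj k Mh R hMh hM hR hRM P hP hP4 D a c haw hcw hac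
  obtain ⟨δ, C, M₁, N₁, hδ, hC, hM₁, hN₁, h⟩ := thm314_flat_master d ℓ ha (ι := Unit)
    (fun _ Mh k P => (1 : Matrix ↥(boxDom (N0 ℓ Mh k P)) ↥(boxDom (N0 ℓ Mh k P)) ℝ))
    (fun _ Mh k P => (1 : Matrix ↥(boxDom (N0 ℓ Mh k P)) ↥(boxDom (N0 ℓ Mh k P)) ℝ))
    (fun Mh k P => (1 : Matrix ↥(boxDom (N0 ℓ Mh k P)) ↥(boxDom (N0 ℓ Mh k P)) ℝ)) (fun _ _ _ => rfl)
    (nT := 2) (nL := 2) (m := 2) rfl (half_pos hδ₀) hC₀ hM₀ (half_pos hδ₀) hC₀ (half_pos hδ₀) hC₀ hF hF hF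
  refine ⟨δ, C, M₁, N₁, hδ, hC, hM₁, hN₁, ?_⟩
  intro k Mh R hMh hM hR hRM P hP hP4 D D' a c haw hcw hac p q hpD hpD' hqD hqD' hp hq lam B hlam x hx
  have h1 := h k Mh R hMh hM hR hRM P hP hP4 D D' a c haw hcw hac p q hpD hpD' hqD hqD' hp hq lam B hlam x hx ()
  rw [Matrix.one_mul, Matrix.mul_one, Matrix.one_mul, Matrix.mul_one] at h1
  exact h1

/-- **NON-VACUITY**: the hypotheses of `thm314_Gp_flat_multiLevelTorus` are met — for every `M₀`, `N₀` there are admissible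
`M_h, R, P`, two torus families and common top blocks (e.g. the trivial family `Ω₁ = … = Ω_k = T_η` twice; every block is
then a top block). [cite: Balaban1984PropagatorsII, (2.1) p.224 («we admit the case when some domains Ω_j are equal to T_η»)] -/
theorem thm314_Gp_flat_nonvacuous (d ℓ : ℕ) (M₀ : ℝ) (N₀ k : ℕ) (hk : 1 ≤ k) :
    ∃ (Mh R : ℕ) (P : Fin (d + 1) → ℕ) (D D' : TDomains d ℓ Mh k P R),
      3 ≤ Mh ∧ M₀ ≤ ((ℓ : ℝ) + 1) * Mh ∧ 2 * (ℓ + 1) ≤ R ∧ N₀ + 1 ≤ R * ((ℓ + 1) * Mh) ∧ (∀ μ, 4 ≤ P μ) ∧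
      ∃ p : ℕ × (Fin (d + 1) → ℤ), p ∈ bset D.toDomains ∧ p ∈ bset D'.toDomains ∧ p.1 = k := by
  set Mh : ℕ := max 3 ⌈M₀⌉₊ with hMh
  set R : ℕ := max (2 * (ℓ + 1)) (N₀ + 1) with hR
  set P : Fin (d + 1) → ℕ := fun _ => 4
  set D := TDomains.top d ℓ Mh k P R hk
  have hMh3 : 3 ≤ Mh := le_max_left _ _
  refine ⟨Mh, R, P, D, D, hMh3, ?_, le_max_left _ _, ?_, fun _ => le_rfl, ?_⟩
  · have h1 : M₀ ≤ ⌈M₀⌉₊ := Nat.le_ceil _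
    have h2 : ((⌈M₀⌉₊ : ℕ) : ℝ) ≤ Mh := by rw [hMh]; exact_mod_cast le_max_right _ _
    have h3 : (Mh : ℝ) ≤ ((ℓ : ℝ) + 1) * Mh := by
      have : (0 : ℝ) ≤ Mh := by positivity
      nlinarith
    linarith
  · calc N₀ + 1 ≤ R := le_max_right _ _
      _ = R * 1 := (mul_one R).symm
      _ ≤ R * ((ℓ + 1) * Mh) := Nat.mul_le_mul_left _ (by nlinarith)
  · have hP1 : ∀ μ, 1 ≤ P μ := fun _ => by norm_num
    have hMh1 : 1 ≤ Mh := le_trans (by norm_num) hMh3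
    obtain x : ↥(boxDom (N0 ℓ Mh k P)) := ⟨0, by
      rw [mem_boxDom]; intro μ
      have : 1 ≤ N0 ℓ Mh k P μ := one_le_N0 hMh1 hP1 μ
      simp only [Pi.zero_apply]; exact ⟨le_rfl, by exact_mod_cast this⟩⟩
    exact ⟨(blkOf D.toDomains x).1, (blkOf D.toDomains x).2, (blkOf D.toDomains x).2, rfl⟩

end Main

end

end Literature.MathematicalPhysics.QuantumFieldTheory.Balaban1983to89.B9Thm314GpFlatMultiLevelTorus
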